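import Literature.NumberTheory.GaloisRepresentations.ArtinConductorLocalProofs
import Literature.NumberTheory.GaloisRepresentations.ArtinRepresentationModularProofs
import HarnessLib

/-!
# The local Artin conductor for `ρ|_{I_F}` through a finite quotient, in every coefficient
characteristic `≠ p`, reduced to the Hasse–Arf theorem alone (trunk GalRep, item C10; provefact
`GaloisRep.natCast_localArtinConductor_of_hasOpenInertiaKerAt`)

Theorems only (no definitions, no named facts).  `ArtinConductorLocalProofs.lean` reduces the named
fact `Literature.NumberTheory.GaloisRepresentations.GaloisRep.natCast_localArtinConductor_of_hasOpenInertiaKerAt`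
(`ArtinConductor.lean`; Katz, *Gauss Sums, Kloosterman Sums, and Monodromy Groups*, Ch. 1,
Prop. 1.9, finite-quotient form, over a non-archimedean local field `F` of any characteristic) to
two inputs (`natCast_localArtinConductor_of_hasOpenInertiaKerAt_of_hasseArf`): the Hasse–Arf
theorem `hasseArf` and — for coefficient fields of positive characteristic `ℓ ≠ p` only — Artin's
theorem over *finite* coefficient fields for the inertia groups `I(𝔓 ∩ E) ≤ Gal(E/F)` of the
finite Galois layers `E` of `F̄/F` (the hypothesis `hfin`; Katz 1.9 for `A = 𝔽_λ`, whose printed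
proof is Serre, *Linear Representations* §19.3 with Thm 44).  This file **removes the second
input**: the finite-field case follows from the same two arithmetic inputs as the
characteristic-`0` case — the integrality of the different exponent
(`card_inf_inertia_dvd_finsum_lowerIndex_holds`, proved in the tree) and the degree-one
integrality (HA) = `card_inf_inertia_dvd_finsum_card_inf_ramificationSubgroup` (Herbrand +
Hasse–Arf, reduced in the tree to `hasseArf`) — by the detour through Brauer characters
(Serre, *Linear Representations*, §18.1, §18.4 Thm 43 (i)), formalised at the generic Dedekind
level in `ArtinRepresentationModularProofs.exists_natCast_eq_artinExponent_core_finite`, which we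
instantiate at `R = 𝒪[F]`, `𝔔 = 𝔓 ∩ E`, `p = char 𝓀[F]`:

* `exists_natCast_eq_artinExponent_inertia_local_finite` — Artin's theorem `f(τ) ∈ ℕ` for a
  representation `τ` of `I(𝔓 ∩ E)` over a *finite* field `κ` with `(p : κ) ≠ 0`, from (HA) for the
  layer `E`;
* `exists_natCast_eq_artinExponent_inertia_local_of_HA` — the same over every coefficient field
  `A` with `(q_F : A) ≠ 0` (`exists_natCast_eq_artinExponent_inertia_local` with its `hfin`
  discharged by the previous item);
* `GaloisRep.natCast_localArtinConductor_of_hasOpenInertiaKerAt_of_HA`,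
  **`GaloisRep.natCast_localArtinConductor_of_hasOpenInertiaKerAt_of_hasseArf'`** — the named fact
  from (HA) for the finite layers of `F̄/F`, resp. **from the Hasse–Arf theorem alone** (for the
  finite Galois extensions of Dedekind fraction fields in the universe of `F`).  Once `hasseArf` is
  discharged by a universe-polymorphic `hasseArf_holds`,
  `natCast_localArtinConductor_of_hasOpenInertiaKerAt_holds :=
    natCast_localArtinConductor_of_hasOpenInertiaKerAt_of_hasseArf' (fun R' _ _ => hasseArf_holds R')`.

Remaining trust base: `Literature.NumberTheory.GaloisRepresentations.hasseArf` (Serre IV §3 / V §7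
Thm 1), a named fact of `ArtinRepresentation.lean`.

## References

* N. M. Katz, *Gauss Sums, Kloosterman Sums, and Monodromy Groups*, Ann. of Math. Studies 116,
  Princeton 1988, Ch. 1, Prop. 1.9 and its proof (reduction to `A = 𝔽_λ`, then [Se-2] 19.3),
  Remark 1.10. [Katz1988]
* J.-P. Serre, *Local Fields*, GTM 67 (1979), Ch. IV §3 Theorem (Hasse–Arf); Ch. VI §2, Thm 1'
  and its proof, Cor. 1' (pp. 99–103). [SerreLocalFields1979]
* J.-P. Serre, *Linear Representations of Finite Groups*, GTM 42 (1977), §18.1 (ix), §18.4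
  Thm 43 (i), §19.3 (iii). [SerreLinearRepresentations1977]
-/

noncomputable section

open scoped Valued
open Field IsDedekindDomain Module ValuativeRel
open Literature.NumberTheory.GaloisRepresentations.IsNonarchimedeanLocalField

namespace Literature.NumberTheory.GaloisRepresentations

universe u v w

/-! ### Artin's theorem for the inertia group of a finite layer of `F̄/F`, all coefficients -/

section ArtinLocal

variable {F : Type u} [Field F] [ValuativeRel F] [TopologicalSpace F] [IsNonarchimedeanLocalField F]
  {A : Type v} [Field A] {M : Type w} [AddCommGroup M] [Module A M]

/-- **Artin's theorem over a finite coefficient field for the inertia group of a finite Galois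
layer `E/F` of `F̄`, from the degree-one integrality** (the hypothesis `hfin` of
`exists_natCast_eq_artinExponent_inertia_local`, discharged).  Let `F` be a non-archimedean local
field (any characteristic) with residue characteristic `p`, `E/F` a finite Galois subextension of
`F̄`, `G_0 = I(𝔓 ∩ E) ≤ Gal(E/F)`, and `τ` a representation of `G_0` on a finite-dimensional
vector space over a *finite* field `A` with `(p : A) ≠ 0`.  If (HA) =
`card_inf_inertia_dvd_finsum_card_inf_ramificationSubgroup 𝒪[F]` holds for the layer `E`
(Serre VI §2 Cor. to Prop. 5: Herbrand + Hasse–Arf), then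
`f(τ) = Σ_{i ≥ 0} (g_i/g_0) codim M^{G_i} ∈ ℕ`.  This is Katz's Prop. 1.9 for `A = 𝔽_λ`
(whose printed proof is *LinRep* §19.3 via Thm 44), obtained by
`exists_natCast_eq_artinExponent_core_finite` (Brauer characters, *LinRep* Thm 43 (i), and the
characteristic-`0` core) at `R = 𝒪[F]`, `𝔔 = 𝔓 ∩ E` (maximal, finite residue field, so the
residue extension is separable), `p = char 𝓀[F] ∈ 𝔔`, with the different input
`card_inf_inertia_dvd_finsum_lowerIndex_holds`.
Ref: Katz (1988), Ch. 1, Prop. 1.9 (proof); Serre, *Local Fields*, Ch. VI §2 Thm 1' (proof);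
Serre, *Linear Representations*, §18.4 Thm 43 (i), §19.3 (iii).
[cite: Katz1988, Ch. 1, Prop. 1.9 (and its proof)]
[cite: SerreLinearRepresentations1977, §18.4 Thm 43 (i) and §19.3 (iii)] -/
theorem exists_natCast_eq_artinExponent_inertia_local_finite [Finite A]
    (E : IntermediateField F (AlgebraicClosure F)) [FiniteDimensional F E] [IsGalois F E]
    (hHA : card_inf_inertia_dvd_finsum_card_inf_ramificationSubgroup 𝒪[F] (K := F) (L := E))
    [FiniteDimensional A M]
    (τ : Representation A (((absMaximalIdeal F).comap (E.integralClosureToAbsIntegers 𝒪[F])).inertia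
      (E ≃ₐ[F] E)) M)
    (hp : ((ringChar 𝓀[F] : ℕ) : A) ≠ 0) :
    ∃ n : ℕ, (n : ℝ) =
      artinExponent ((absMaximalIdeal F).comap (E.integralClosureToAbsIntegers 𝒪[F])) (E ≃ₐ[F] E)
        (((absMaximalIdeal F).comap (E.integralClosureToAbsIntegers 𝒪[F])).inertia
          (E ≃ₐ[F] E)).subtype τ := by
  classical
  haveI : (absMaximalIdeal F).IsMaximal := absMaximalIdeal_isMaximal_holds F
  haveI : Finite (𝒪[F] ⧸ (absMaximalIdeal F).under 𝒪[F]) := finite_quotient_under_absMaximalIdeal F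
  haveI := isMaximal_comap_integralClosureToAbsIntegers 𝒪[F] (absMaximalIdeal F) E
  haveI := isSeparable_residue_comap 𝒪[F] (absMaximalIdeal F) E
  haveI := Fact.mk (ringChar_residueField_prime (F := F))
  exact exists_natCast_eq_artinExponent_core_finite 𝒪[F]
    ((absMaximalIdeal F).comap (E.integralClosureToAbsIntegers 𝒪[F])) _ rfl
    (natCast_ringChar_mem_comap_absMaximalIdeal F E)
    (card_inf_inertia_dvd_finsum_lowerIndex_holds 𝒪[F] (K := F) (L := E)) hHA τ hp

/-- **Artin's integrality theorem for the inertia group of a finite Galois layer `E/F` of `F̄`,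
over every coefficient field `A` with `(q_F : A) ≠ 0`, from the degree-one integrality (HA)
alone** (`exists_natCast_eq_artinExponent_inertia_local` with its finite-field input supplied by
`exists_natCast_eq_artinExponent_inertia_local_finite`): `f(τ) ∈ ℕ` for every finite-dimensional
representation `τ` of `I(𝔓 ∩ E)` over `A`.  Serre's Thm VI.1' with its printed proof (Brauer's
induction theorem, proved in the tree, and the two arithmetic inputs) in characteristic `0`, and
Katz's reduction 1.9 (`A ⊇ 𝔽_ℓ`: base change from a finite field, then Brauer characters) in
characteristic `ℓ ≠ p`.
Ref: Serre, *Local Fields*, Ch. VI §2, Thm 1' (proof, p. 103); Katz (1988), Ch. 1, Prop. 1.9.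
[cite: SerreLocalFields1979, Ch. VI §2, Thm 1' (proof)]
[cite: Katz1988, Ch. 1, Prop. 1.9 (and its proof)] -/
theorem exists_natCast_eq_artinExponent_inertia_local_of_HA
    (E : IntermediateField F (AlgebraicClosure F)) [FiniteDimensional F E] [IsGalois F E]
    (hHA : card_inf_inertia_dvd_finsum_card_inf_ramificationSubgroup 𝒪[F] (K := F) (L := E))
    [FiniteDimensional A M]
    (τ : Representation A (((absMaximalIdeal F).comap (E.integralClosureToAbsIntegers 𝒪[F])).inertia
      (E ≃ₐ[F] E)) M)
    (hchar : (residueFieldCard F : A) ≠ 0) :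
    ∃ n : ℕ, (n : ℝ) =
      artinExponent ((absMaximalIdeal F).comap (E.integralClosureToAbsIntegers 𝒪[F])) (E ≃ₐ[F] E)
        (((absMaximalIdeal F).comap (E.integralClosureToAbsIntegers 𝒪[F])).inertia
          (E ≃ₐ[F] E)).subtype τ :=
  exists_natCast_eq_artinExponent_inertia_local E hHA τ hchar
    fun _ _ _ _ _ _ _ τ' hp => exists_natCast_eq_artinExponent_inertia_local_finite E hHA τ' hp

end ArtinLocal

/-! ### The corrected named fact from (HA), and from the Hasse–Arf theorem alone -/

namespace GaloisRep

section Assembly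

variable {F : Type u} [Field F] [ValuativeRel F] [TopologicalSpace F] [IsNonarchimedeanLocalField F]

/-- **The corrected named fact from the degree-one integrality alone** (all coefficient
characteristics `≠ p`; `F` of any characteristic): `natCast_localArtinConductor_of_hasOpenInertiaKerAt_of_arith`
with its finite-field input `hfin` discharged by `exists_natCast_eq_artinExponent_inertia_local_finite`.
Hypothesis: (HA) = `card_inf_inertia_dvd_finsum_card_inf_ramificationSubgroup 𝒪[F]` (Serre VI §2
Cor. to Prop. 5: Herbrand + Hasse–Arf) for the finite layers `E` of `F̄/F`.  Conclusion: for every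
finite-dimensional `ρ : Γ_F → GL(M)` over a field `A` with `(q_F : A) ≠ 0` and `ρ|_{I_F}` through
a finite quotient, `(localArtinConductor ρ : ℝ) = codim M^{I_F} + sw(ρ)`.
Ref: Katz (1988), Ch. 1, Prop. 1.9 and its proof; Serre, *Local Fields*, Ch. VI §2, Thm 1'.
[cite: Katz1988, Ch. 1, Prop. 1.9 (and its proof)]
[cite: SerreLocalFields1979, Ch. VI §2, Thm 1' (proof)] -/
theorem natCast_localArtinConductor_of_hasOpenInertiaKerAt_of_HA
    (hHA : ∀ E : IntermediateField F (AlgebraicClosure F),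
      card_inf_inertia_dvd_finsum_card_inf_ramificationSubgroup 𝒪[F] (K := F) (L := E)) :
    natCast_localArtinConductor_of_hasOpenInertiaKerAt.{u, v, w} (F := F) :=
  natCast_localArtinConductor_of_hasOpenInertiaKerAt_of_arith hHA
    fun E _ _ _ _ _ _ τ' hp => exists_natCast_eq_artinExponent_inertia_local_finite E (hHA E) τ' hp

/-- **Katz's Proposition 1.9 (finite-quotient form) from the Hasse–Arf theorem alone.**  For a
non-archimedean local field `F` of any characteristic, every field `A` with `(q_F : A) ≠ 0` (any
characteristic `≠ p`, any topology) and every finite-dimensional `ρ : Γ_F → GL(M)` whose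
restriction to `I_F` factors through a finite quotient, `(localArtinConductor ρ : ℝ) =
codim M^{I_F} + sw(ρ)` — i.e. the named fact
`natCast_localArtinConductor_of_hasOpenInertiaKerAt` — granted the Hasse–Arf theorem `hasseArf`
for the finite Galois extensions of Dedekind fraction fields in the universe of `F` (as a
universe-polymorphic discharge `hasseArf_holds` provides).  The degree-one integrality is
`card_inf_inertia_dvd_finsum_card_inf_ramificationSubgroup_of_hasseArf`
(`ArtinRepresentationHasseArfProofs`: Serre's Cor. to Prop. VI.5 from Herbrand's theorem and
Hasse–Arf); the rest is `natCast_localArtinConductor_of_hasOpenInertiaKerAt_of_HA` (Brauer's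
induction theorem in characteristic `0`, Brauer characters in characteristic `ℓ`, both proved in
the tree).  This supersedes `natCast_localArtinConductor_of_hasOpenInertiaKerAt_of_hasseArf`
(which still carried the finite-field input `hfin`).
Ref: Katz (1988), Ch. 1, Prop. 1.9 (and its proof); Serre, *Local Fields*, Ch. IV §3 Theorem
(Hasse–Arf), Ch. VI §2 Thm 1', Cor. 1'; Serre, *Linear Representations*, §18.4 Thm 43, §19.3.
[cite: Katz1988, Ch. 1, Prop. 1.9 (and its proof)]
[cite: SerreLocalFields1979, Ch. IV §3, Theorem (Hasse–Arf)] -/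
theorem natCast_localArtinConductor_of_hasOpenInertiaKerAt_of_hasseArf'
    (hHA : ∀ (R' K' L' : Type u) [CommRing R'] [Field K'] [Field L'] [Algebra R' K']
      [Algebra R' L'] [Algebra K' L'] [IsScalarTower R' K' L'], hasseArf R' (K := K') (L := L')) :
    natCast_localArtinConductor_of_hasOpenInertiaKerAt.{u, v, w} (F := F) :=
  natCast_localArtinConductor_of_hasOpenInertiaKerAt_of_HA
    fun _ => card_inf_inertia_dvd_finsum_card_inf_ramificationSubgroup_of_hasseArf hHA

end Assembly

end GaloisRep

end Literature.NumberTheory.GaloisRepresentations
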